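import Summits.Ventures.LatticeQCDFlow.Scaling.SwapAcceptanceLadder

/-!
HONEST FRAMING: exact (Metropolis-corrected) sampling algorithms for lattice gauge theory; figures
of merit are autocorrelation/cost numbers at stated couplings and volumes; no continuum-physics
claim.

# ParallelTemperingTaggedReplica — THE STATE OF REPLICA EXCHANGE WITH A TAGGED REPLICA: THE PRODUCT OF THE
# LEVEL LAWS TIMES THE UNIFORM TAG ON `Fin (K+1) × (Fin (K+1) → Ω)`, THE ADJACENT-SWAP METROPOLIS RATIOS, AND
# THEIR STATIONARY MEAN `= (2/(K+1))·Σ_j swapAcc(β_j, β_{j+1})` (lean-2 GEN-13, ours)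

Venture-side (OURS).  Cell `lqcd-flow` (pub-lqcd), unit `pub-lqcd-lean-2-g13`, 2026-08-23.  GEN-11 priced the
replica-exchange SWAP between couplings `s < t` (`Scaling/SwapAcceptanceLaw` / `SwapAcceptanceLadder`:
`swapAcc X μ s t = ∫∫ min(1, e^{(t−s)(X x − X y)}) dμ_s dμ_t ≤ exp(−m(t−s)²/4)` under a variance floor, and
`Ω((b−a)√m)` replicas) — for parallel tempering and for PTBC (`Scaling/DefectSwapAcceptance`); round-trip /
autocorrelation statements stayed NOT CLAIMED.  The companion `Scaling/ParallelTemperingDiffusive` proves the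
diffusive law for the level of a TAGGED replica; this file types its objects:

* **`ptTaggedTarget X μ β K`** `= (K+1)⁻¹·Σ_τ δ_τ ⊗ (⊗_{k ≤ K} μ_{β_k})` on `Fin (K+1) × (Fin (K+1) → Ω)` — the
  stationary law of replica exchange (independent levels, `μ_u = μ.tilted(u·X)`) together with the level `τ`
  currently holding the tagged replica, uniformly distributed (the tag is exchangeable); `integral_ptTaggedTarget`,
  `isProbabilityMeasure_ptTaggedTarget`, `measurable_ptLevel`, `ptTaggedTarget_real_level`;
* **`ptSwapRatio X β K (τ, x)`** `= Σ_{j<K} ptTagCoef K j τ · ptPairRatio X β K j x`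
  `= Σ_{j<K} (1[j = τ] + 1[j+1 = τ])·min(1, e^{(β_{j+1}−β_j)(X(x_j) − X(x_{j+1}))})` — the Metropolis ratios of the
  (at most two) adjacent swaps that can move the tag, an upper bound for the probability that one swap attempt /
  one half-sweep of disjoint adjacent swaps moves it (`ptPairRatio`, `ptTagCoef` the two factors);
  `measurable_ptSwapRatio`, `ptSwapRatio_nonneg`, `ptSwapRatio_le`, `sum_ptTagCoef`;
* `map_pair_pi_tilted` — under `⊗_k μ_{β_k}` the pair `(x_j, x_{j+1})` has law `μ_{β_j} ⊗ μ_{β_{j+1}}`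
  (Mathlib `iIndepFun_pi`); `integral_ptPairRatio_eq_swapAcc` — so each ratio integrates to GEN-11's `swapAcc`;
  **`pt_moveRate_eq`** — `∫ ptSwapRatio dπ = (2/(K+1))·Σ_{j<K} swapAcc X μ β_j β_{j+1}`.

NOT CLAIMED: a construction of the replica-exchange kernel on the tagged space (the law downstream quantifies
over all kernels leaving `ptTaggedTarget` invariant); full sequential swap sweeps (the tag may then move by more
than one level per step — use half-sweeps of disjoint pairs or single attempts as the step).  Literature grade
(cell rule): bookkeeping, NEW TYPING; nothing cited as a fact.
-/

noncomputable section

open MeasureTheory ProbabilityTheory Set Filter Finset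
open scoped ENNReal

namespace Summit.Ventures.LatticeQCDFlow.Scaling

/-! ## §1 The tagged-replica target -/

section Target

variable {Ω : Type*} [MeasurableSpace Ω]

/-- **The replica-exchange state with a tagged replica**: `(K+1)⁻¹·Σ_τ δ_τ ⊗ (⊗_k μ_{β_k})` on
`Fin (K+1) × (Fin (K+1) → Ω)` — configurations at the `K+1` levels independent with laws `μ_{β_k} = μ.tilted(β_k·X)`,
and the level `τ` of the tagged replica uniform. [ours] -/
def ptTaggedTarget (X : Ω → ℝ) (μ : Measure Ω) (β : ℕ → ℝ) (K : ℕ) : Measure (Fin (K + 1) × (Fin (K + 1) → Ω)) :=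
  ((K + 1 : ℕ) : ℝ≥0∞)⁻¹ • ∑ τ : Fin (K + 1),
    (Measure.pi fun k : Fin (K + 1) => μ.tilted fun x => β k * X x).map (Prod.mk τ)

variable {X : Ω → ℝ} {μ : Measure Ω} [IsProbabilityMeasure μ] {β : ℕ → ℝ} {K : ℕ}

/-- The product of the level laws is a probability measure. [folklore] -/
theorem isProbabilityMeasure_pi_tilted (hXm : Measurable X) (hXb : ∃ C, ∀ x, |X x| ≤ C) :
    IsProbabilityMeasure (Measure.pi fun k : Fin (K + 1) => μ.tilted fun x => β k * X x) := by
  haveI : ∀ k : Fin (K + 1), IsProbabilityMeasure (μ.tilted fun x => β k * X x) := fun k =>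
    isProbabilityMeasure_tilted_mul (μ := μ) hXm hXb (β k)
  infer_instance

omit [IsProbabilityMeasure μ] in
/-- Integration against the tagged target: `∫ g dπ = (K+1)⁻¹·Σ_τ ∫ g(τ, x) d(⊗μ_{β_k})(x)` for bounded measurable
`g`. [ours] -/
theorem integral_ptTaggedTarget
    {g : Fin (K + 1) × (Fin (K + 1) → Ω) → ℝ} (hgm : Measurable g) {C : ℝ} (hgb : ∀ z, |g z| ≤ C) :
    ∫ z, g z ∂(ptTaggedTarget X μ β K) =
      1 / (K + 1) * ∑ τ : Fin (K + 1), ∫ x, g (τ, x) ∂(Measure.pi fun k : Fin (K + 1) => μ.tilted fun x => β k * X x) := by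
  unfold ptTaggedTarget
  have hint : ∀ τ : Fin (K + 1), Integrable g
      ((Measure.pi fun k : Fin (K + 1) => μ.tilted fun x => β k * X x).map (Prod.mk τ)) := fun τ => by
    haveI : IsFiniteMeasure ((Measure.pi fun k : Fin (K + 1) => μ.tilted fun x => β k * X x).map (Prod.mk τ)) :=
      Measure.isFiniteMeasure_map _ _
    exact Integrable.of_bound hgm.aestronglyMeasurable C (ae_of_all _ fun z => by
      rw [Real.norm_eq_abs]; exact hgb z)
  rw [integral_smul_measure, integral_finsetSum_measure fun τ _ => hint τ, ENNReal.toReal_inv,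
    ENNReal.toReal_natCast, smul_eq_mul]
  push_cast
  rw [← one_div]
  congr 1
  refine Finset.sum_congr rfl fun τ _ => ?_
  rw [integral_map measurable_prodMk_left.aemeasurable hgm.aestronglyMeasurable]

/-- The tagged target is a probability measure. [ours] -/
theorem isProbabilityMeasure_ptTaggedTarget (hXm : Measurable X) (hXb : ∃ C, ∀ x, |X x| ≤ C) :
    IsProbabilityMeasure (ptTaggedTarget X μ β K) := by
  haveI := isProbabilityMeasure_pi_tilted (μ := μ) (β := β) (K := K) hXm hXb
  constructor
  have h : ∀ τ : Fin (K + 1),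
      (Measure.pi fun k : Fin (K + 1) => μ.tilted fun x => β k * X x).map (Prod.mk τ) univ = 1 := fun τ => by
    rw [Measure.map_apply measurable_prodMk_left MeasurableSet.univ, Set.preimage_univ, measure_univ]
  simp only [ptTaggedTarget, Measure.smul_apply, Measure.coe_finsetSum, Finset.sum_apply, h, Finset.sum_const,
    Finset.card_univ, Fintype.card_fin, smul_eq_mul, nsmul_eq_mul, mul_one]
  exact ENNReal.inv_mul_cancel (by simp) (ENNReal.natCast_ne_top _)

/-- The tag `z ↦ z.1` (as a natural number) is measurable. [folklore] -/
theorem measurable_ptLevel : Measurable fun z : Fin (K + 1) × (Fin (K + 1) → Ω) => ((z.1 : Fin (K + 1)) : ℕ) :=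
  (measurable_of_countable fun j : Fin (K + 1) => (j : ℕ)).comp measurable_fst

/-- **The tag is uniform**: every level carries tag-mass `1/(K+1)`. [ours] -/
theorem ptTaggedTarget_real_level (hXm : Measurable X) (hXb : ∃ C, ∀ x, |X x| ≤ C) (k : ℕ) (hk : k ≤ K) :
    (ptTaggedTarget X μ β K).real {z | ((z.1 : Fin (K + 1)) : ℕ) = k} = 1 / (K + 1) := by
  haveI := isProbabilityMeasure_pi_tilted (μ := μ) (β := β) (K := K) hXm hXb
  have hS : MeasurableSet {z : Fin (K + 1) × (Fin (K + 1) → Ω) | ((z.1 : Fin (K + 1)) : ℕ) = k} :=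
    measurable_ptLevel (measurableSet_singleton k)
  rw [← integral_indicator_one hS]
  set S : Set (Fin (K + 1) × (Fin (K + 1) → Ω)) := {z | ((z.1 : Fin (K + 1)) : ℕ) = k} with hS_def
  have hgm : Measurable (S.indicator (1 : Fin (K + 1) × (Fin (K + 1) → Ω) → ℝ)) := measurable_const.indicator hS
  have hgb : ∀ z, |(S.indicator (1 : Fin (K + 1) × (Fin (K + 1) → Ω) → ℝ)) z| ≤ 1 := fun z => by
    by_cases hz : z ∈ S
    · rw [Set.indicator_of_mem hz]; simp
    · rw [Set.indicator_of_notMem hz]; simp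
  rw [integral_ptTaggedTarget hgm hgb]
  have e : ∀ j : Fin (K + 1), ∫ x, S.indicator (1 : Fin (K + 1) × (Fin (K + 1) → Ω) → ℝ) (j, x)
      ∂(Measure.pi fun k : Fin (K + 1) => μ.tilted fun x => β k * X x) =
      if j = ⟨k, Nat.lt_succ_of_le hk⟩ then 1 else 0 := by
    intro j
    by_cases hj : j = ⟨k, Nat.lt_succ_of_le hk⟩
    · have hmem : ∀ x : Fin (K + 1) → Ω, ((j, x) : Fin (K + 1) × (Fin (K + 1) → Ω)) ∈ S := fun x => by
        rw [hS_def, Set.mem_setOf_eq, hj]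
      simp only [Set.indicator_of_mem (hmem _), Pi.one_apply, integral_const, probReal_univ, smul_eq_mul,
        mul_one, if_pos hj]
    · have hnot : ∀ x : Fin (K + 1) → Ω, ((j, x) : Fin (K + 1) × (Fin (K + 1) → Ω)) ∉ S := fun x => by
        rw [hS_def, Set.mem_setOf_eq]
        intro h
        exact hj (Fin.ext h)
      simp only [Set.indicator_of_notMem (hnot _), integral_zero, if_neg hj]
  simp only [e, Finset.sum_ite_eq', Finset.mem_univ, if_true, mul_one]

end Target

/-! ## §2 The adjacent-swap Metropolis ratios seen by the tag -/

section Ratio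

variable {Ω : Type*} [MeasurableSpace Ω]

/-- The Metropolis ratio of exchanging the configurations at levels `j` and `j+1` under `⊗_k μ_{β_k}`:
`min(1, e^{(β_{j+1}−β_j)(X(x_j) − X(x_{j+1}))})`. [ours] -/
def ptPairRatio (X : Ω → ℝ) (β : ℕ → ℝ) (K : ℕ) (j : Fin K) (x : Fin (K + 1) → Ω) : ℝ :=
  min 1 (Real.exp ((β ((j : ℕ) + 1) - β (j : ℕ)) * (X (x (Fin.castSucc j)) - X (x (Fin.succ j)))))

/-- The incidence coefficient of the tag at level `τ` with the pair `(j, j+1)`: `1[j = τ] + 1[j+1 = τ]`. [ours] -/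
def ptTagCoef (K : ℕ) (j : Fin K) (τ : Fin (K + 1)) : ℝ :=
  (if Fin.castSucc j = τ then (1 : ℝ) else 0) + (if Fin.succ j = τ then 1 else 0)

/-- **The swap ratios that can move the tag** at `(τ, x)`: `Σ_{j<K} (1[j = τ] + 1[j+1 = τ])·min(1, e^{(β_{j+1}−β_j)(X(x_j)−X(x_{j+1}))})`
— an upper bound for the probability that one swap attempt / one half-sweep of disjoint adjacent swaps moves the
tag. [ours] -/
def ptSwapRatio (X : Ω → ℝ) (β : ℕ → ℝ) (K : ℕ) (z : Fin (K + 1) × (Fin (K + 1) → Ω)) : ℝ :=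
  ∑ j : Fin K, ptTagCoef K j z.1 * ptPairRatio X β K j z.2

variable {X : Ω → ℝ} {μ : Measure Ω} {β : ℕ → ℝ} {K : ℕ}

/-- One pair ratio is measurable in the configuration vector. [folklore] -/
theorem measurable_ptPairRatio (hXm : Measurable X) (j : Fin K) : Measurable (ptPairRatio X β K j) :=
  measurable_const.min (Real.measurable_exp.comp (measurable_const.mul
    ((hXm.comp (measurable_pi_apply _)).sub (hXm.comp (measurable_pi_apply _)))))

omit [MeasurableSpace Ω] in
/-- `0 ≤ ptPairRatio ≤ 1`. [folklore] -/
theorem ptPairRatio_mem (j : Fin K) (x : Fin (K + 1) → Ω) :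
    0 ≤ ptPairRatio X β K j x ∧ ptPairRatio X β K j x ≤ 1 :=
  ⟨le_min zero_le_one (Real.exp_pos _).le, min_le_left _ _⟩

/-- `0 ≤ ptTagCoef ≤ 2`. [folklore] -/
theorem ptTagCoef_mem (j : Fin K) (τ : Fin (K + 1)) : 0 ≤ ptTagCoef K j τ ∧ ptTagCoef K j τ ≤ 2 := by
  unfold ptTagCoef
  constructor <;> split_ifs <;> norm_num

/-- Each pair is incident to exactly two tag values: `Σ_τ ptTagCoef K j τ = 2`. [folklore] -/
theorem sum_ptTagCoef (j : Fin K) : ∑ τ : Fin (K + 1), ptTagCoef K j τ = 2 := by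
  unfold ptTagCoef
  rw [Finset.sum_add_distrib, Finset.sum_ite_eq, Finset.sum_ite_eq]
  simp only [Finset.mem_univ, if_true]
  norm_num

/-- The tag's swap ratio is measurable. [ours] -/
theorem measurable_ptSwapRatio (hXm : Measurable X) : Measurable (ptSwapRatio X β K) := by
  refine measurable_from_prod_countable_right fun τ => ?_
  unfold ptSwapRatio
  dsimp only
  exact Finset.measurable_sum _ fun j _ => (measurable_ptPairRatio (β := β) hXm j).const_mul _

omit [MeasurableSpace Ω] in
/-- The tag's swap ratio is nonnegative. [ours] -/
theorem ptSwapRatio_nonneg (z : Fin (K + 1) × (Fin (K + 1) → Ω)) : 0 ≤ ptSwapRatio X β K z :=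
  Finset.sum_nonneg fun j _ => mul_nonneg (ptTagCoef_mem j z.1).1 (ptPairRatio_mem j z.2).1

omit [MeasurableSpace Ω] in
/-- The tag's swap ratio is at most `2K` (a crude bound, used only for integrability). [ours] -/
theorem ptSwapRatio_le (z : Fin (K + 1) × (Fin (K + 1) → Ω)) : ptSwapRatio X β K z ≤ 2 * K := by
  unfold ptSwapRatio
  calc ∑ j : Fin K, ptTagCoef K j z.1 * ptPairRatio X β K j z.2 ≤ ∑ _j : Fin K, (2 : ℝ) :=
        Finset.sum_le_sum fun j _ => by
          have h1 := ptTagCoef_mem j z.1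
          have h2 := ptPairRatio_mem (X := X) (β := β) j z.2
          nlinarith
    _ = 2 * K := by rw [Finset.sum_const, Finset.card_univ, Fintype.card_fin, nsmul_eq_mul]; ring

/-! ### The pair marginal of the product law and the swap acceptance -/

variable [IsProbabilityMeasure μ]

/-- **Under `⊗_k μ_{β_k}` the pair `(x_j, x_{j+1})` has law `μ_{β_j} ⊗ μ_{β_{j+1}}`** (independent coordinates,
Mathlib `iIndepFun_pi`). [folklore] -/
theorem map_pair_pi_tilted (hXm : Measurable X) (hXb : ∃ C, ∀ x, |X x| ≤ C) (j : Fin K) :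
    (Measure.pi fun k : Fin (K + 1) => μ.tilted fun x => β k * X x).map
        (fun x => (x (Fin.castSucc j), x (Fin.succ j))) =
      (μ.tilted fun x => β (Fin.castSucc j) * X x).prod (μ.tilted fun x => β (Fin.succ j) * X x) := by
  haveI : ∀ k : Fin (K + 1), IsProbabilityMeasure (μ.tilted fun x => β k * X x) := fun k =>
    isProbabilityMeasure_tilted_mul (μ := μ) hXm hXb (β k)
  have hind : iIndepFun (fun (i : Fin (K + 1)) (ω : Fin (K + 1) → Ω) => ω i)
      (Measure.pi fun k : Fin (K + 1) => μ.tilted fun x => β k * X x) :=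
    iIndepFun_pi (X := fun _ : Fin (K + 1) => (id : Ω → Ω)) fun _ => aemeasurable_id
  have hne : Fin.castSucc j ≠ Fin.succ j := ne_of_lt Fin.castSucc_lt_succ
  have h2 := hind.indepFun hne
  rw [indepFun_iff_map_prod_eq_prod_map_map (measurable_pi_apply _).aemeasurable
    (measurable_pi_apply _).aemeasurable] at h2
  rw [h2, (measurePreserving_eval _ (Fin.castSucc j)).map_eq, (measurePreserving_eval _ (Fin.succ j)).map_eq]

/-- **Each pair ratio integrates to GEN-11's swap acceptance**: `∫ ptPairRatio_j d(⊗μ_{β_k}) = swapAcc X μ β_j β_{j+1}`.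
[ours] -/
theorem integral_ptPairRatio_eq_swapAcc (hXm : Measurable X) (hXb : ∃ C, ∀ x, |X x| ≤ C) (j : Fin K) :
    ∫ x, ptPairRatio X β K j x ∂(Measure.pi fun k : Fin (K + 1) => μ.tilted fun x => β k * X x) =
      swapAcc X μ (β (j : ℕ)) (β ((j : ℕ) + 1)) := by
  have hg : Measurable fun p : Ω × Ω => min 1 (Real.exp ((β ((j : ℕ) + 1) - β (j : ℕ)) * (X p.1 - X p.2))) :=
    measurable_const.min (Real.measurable_exp.comp (measurable_const.mul
      ((hXm.comp measurable_fst).sub (hXm.comp measurable_snd))))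
  have e := integral_map (μ := Measure.pi fun k : Fin (K + 1) => μ.tilted fun x => β k * X x)
    ((measurable_pi_apply (Fin.castSucc j)).prodMk (measurable_pi_apply (Fin.succ j))).aemeasurable
    hg.aestronglyMeasurable
  unfold ptPairRatio
  rw [← e, map_pair_pi_tilted hXm hXb j]
  unfold swapAcc
  have e1 : (β (Fin.castSucc j) : ℝ) = β (j : ℕ) := by simp
  have e2 : (β (Fin.succ j) : ℝ) = β ((j : ℕ) + 1) := by simp
  rw [e1, e2]

/-- **THE STATIONARY MEAN OF THE TAG'S SWAP RATIO**:
`∫ ptSwapRatio dπ = (2/(K+1))·Σ_{j<K} swapAcc X μ β_j β_{j+1}`. [ours] -/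
theorem pt_moveRate_eq (hXm : Measurable X) (hXb : ∃ C, ∀ x, |X x| ≤ C) :
    ∫ z, ptSwapRatio X β K z ∂(ptTaggedTarget X μ β K) =
      2 / (K + 1) * ∑ j : Fin K, swapAcc X μ (β (j : ℕ)) (β ((j : ℕ) + 1)) := by
  haveI := isProbabilityMeasure_pi_tilted (μ := μ) (β := β) (K := K) hXm hXb
  have hrb : ∀ z, |ptSwapRatio X β K z| ≤ 2 * K := fun z => by
    rw [abs_of_nonneg (ptSwapRatio_nonneg z)]; exact ptSwapRatio_le z
  rw [integral_ptTaggedTarget (measurable_ptSwapRatio hXm) hrb]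
  -- integrate the finite sum term by term at each tag value
  have hi : ∀ j : Fin K, Integrable (ptPairRatio X β K j)
      (Measure.pi fun k : Fin (K + 1) => μ.tilted fun x => β k * X x) := fun j =>
    Integrable.of_bound (measurable_ptPairRatio (β := β) hXm j).aestronglyMeasurable 1
      (ae_of_all _ fun x => by
        rw [Real.norm_eq_abs, abs_of_nonneg (ptPairRatio_mem j x).1]; exact (ptPairRatio_mem j x).2)
  have hτ : ∀ τ : Fin (K + 1), ∫ x, ptSwapRatio X β K (τ, x)
      ∂(Measure.pi fun k : Fin (K + 1) => μ.tilted fun x => β k * X x) =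
      ∑ j : Fin K, ptTagCoef K j τ * swapAcc X μ (β (j : ℕ)) (β ((j : ℕ) + 1)) := by
    intro τ
    unfold ptSwapRatio
    dsimp only
    rw [integral_finsetSum _ fun j _ => (hi j).const_mul _]
    refine Finset.sum_congr rfl fun j _ => ?_
    rw [MeasureTheory.integral_const_mul, integral_ptPairRatio_eq_swapAcc hXm hXb j]
  simp only [hτ]
  -- swap the two finite sums; each pair `(j, j+1)` is counted once from `τ = j` and once from `τ = j+1`
  rw [Finset.sum_comm]
  have hcount : ∀ j : Fin K, ∑ τ : Fin (K + 1), ptTagCoef K j τ * swapAcc X μ (β (j : ℕ)) (β ((j : ℕ) + 1)) =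
      2 * swapAcc X μ (β (j : ℕ)) (β ((j : ℕ) + 1)) := fun j => by
    rw [← Finset.sum_mul, sum_ptTagCoef]
  simp only [hcount, ← Finset.mul_sum]
  ring

end Ratio

end Summit.Ventures.LatticeQCDFlow.Scaling

end
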